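import Summits.BirchSwinnertonDyer.BirchSwinnertonDyer.Theorems.CyclotomicUntwistGNineNineGoodModelLeaves
import Summits.BirchSwinnertonDyer.BirchSwinnertonDyer.Theorems.CyclotomicUntwistPSUntwistedTraceFrobenius
import HarnessLib

/-!
# Every principal-series row has a good model over `𝓞_{ℚ₃(ζ₉)}` whose special-fibre trace, along EVERY reduction
# map, IS `a_w(W) = psUntwistedTrace W`; hence `stub_descendedFrobenius` of line `dfrob` modulo the existence
# fact and a reduction map (route `CyclotomicUntwist`, cruxes K1 `PSRankOneLowerHalfAtThree` / K2)

Cell `pub/bsd-wall` (D-0145 line `route-BirchSwinnertonDyer-CyclotomicUntwist`), seat `bsd-line-cycu-p3` (gen 7).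
Helper toward K1 (stmt-BirchSwinnertonDyer-21580) / K2 (21581), stub `stub_descendedFrobenius` of line `dfrob`
(cycu-p1 g5, registered 2026-08-28T10:39Z). THEOREMS ONLY (no definition, no named fact asserted, no `sorry`);
BSD is not proved by this file and no crux is; the stub is NOT closed (see below). Route-independent.

Bridge (B1) of the lane memo `LAW-La3-KERNEL-v5.md` §2, in the 3-ADIC currency of the Literature definition
`WeierstrassCurve.IsDescendedFrobeniusMatrix` (p623342: `KNine`, `ONine`, `NineGoodModel`, `specialFibreTrace`):

* `exists_specialFibreTrace_of_smul` — transport of «∃ good model with prescribed special-fibre trace ∀ρ» along a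
  change of variables over `KNine` (same integral equation, composed change);
* `exists_nineGoodModel_cubic` — for every integer cubic of the GNineCriterion shape (`3 ∣ A`, `disc = 3^v·d` square,
  `1 ≤ v ≤ 13`, `27 ∣ A² − 3B` if `v ≥ 8`, `3⁵ ∥ P` / `3⁸ ∥ P` at `v = 6 / 12`): a `NineGoodModel` with
  `specialFibreTrace ρ = psUntwistedTrace` for EVERY `ρ` (cusp translation, residue patterns, leaves by
  `exists_nineGoodModel_leafII/IV`, the I₀*-shaped branch excluded by `3⁵ ∥ P`, the `√−3`-rescaling `(2ζ³+1,0,0,0)`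
  — an isomorphism over `KNine ∋ √−3` — for `v ≥ 8`);
* **`exists_nineGoodModel_specialFibreTrace_of_psRow`**: for `W/ℚ` elliptic, globally minimal, `ClassO6 W 3`,
  `v₃(Δ_min)` even, `Δ_min/3^v ≡ 1 (mod 3)`: **`∃ 𝓜 : W.NineGoodModel, ∀ ρ, 𝓜.specialFibreTrace ρ = W.psUntwistedTrace`**;
* **`stub_descendedFrobenius_of_exists`**: the registered stub text of `stub_descendedFrobenius`
  (`∃ M, W.IsDescendedFrobeniusMatrix M ∧ M.trace = ↑W.psUntwistedTrace ∧ M 1 0 ≠ 0` on the PS rows) GRANTED the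
  Literature existence fact `isDescendedFrobeniusMatrix_exists` (Berthelot–Ogus / Katz, PRINT) and ONE reduction map
  `ρ : ONine →+* ZMod 3` (bridge (B2): «`𝓞_{ℚ₃(ζ₉)}` has residue field `𝔽₃`», not in the tree). So the stub as
  registered (without these two inputs in its text) is NOT closed here; this is its kernel part, by name.

References: J. Tate, LNM 476 (1975) §7 [Tate1975]; A. Kraus, Manuscripta Math. 69 (1990), Théorème (p = 3) [Kraus1990];
P. Berthelot, A. Ogus, Invent. Math. 72 (1983) (2.4), (3.14) [BerthelotOgus1983]; N. M. Katz, LNM 868 (1981) §5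
[Katz1981CrystallineDieudonne]; J. H. Silverman, *AEC* VII.1 [SilvermanAEC2009].
-/

-- single-conjunct summit: `Summit.BirchSwinnertonDyer.BirchSwinnertonDyer.…` repeats the name by design
set_option linter.dupNamespace false
set_option autoImplicit false

noncomputable section

open scoped Classical

open WeierstrassCurve Literature.NumberTheory.EllipticCurves.DescendedFrobenius
  Literature.NumberTheory.EllipticCurves Literature.NumberTheory.EllipticCurves.Rank1Residual
  Summit.BirchSwinnertonDyer.Rank1Residual.Additive
  Summit.BirchSwinnertonDyer.BirchSwinnertonDyer.Theorems.GNine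
  Summit.BirchSwinnertonDyer.BirchSwinnertonDyer.Theorems.GNineCriterion

namespace Summit.BirchSwinnertonDyer.BirchSwinnertonDyer.Theorems.GNineFrobeniusTrace

/-! ### Transport along changes of variables over `KNine` -/

/-- **Transport**: if `C₀ • (W ⊗ K) = V ⊗ K` over `K = ℚ₃(ζ₉)` and `V` has a good model with special-fibre trace `t`
along every reduction map, so has `W` (same integral equation, change `C·C₀`). [cite: SilvermanAEC2009, VII.1.3] -/
theorem exists_specialFibreTrace_of_smul {W V : WeierstrassCurve ℚ} (C₀ : VariableChange KNine)
    (h : C₀ • W.map (algebraMap ℚ KNine) = V.map (algebraMap ℚ KNine)) (t : ℤ)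
    (h𝓜 : ∃ 𝓜 : V.NineGoodModel, ∀ ρ : ONine →+* ZMod 3, 𝓜.specialFibreTrace ρ = t) :
    ∃ 𝓜 : W.NineGoodModel, ∀ ρ : ONine →+* ZMod 3, 𝓜.specialFibreTrace ρ = t := by
  obtain ⟨𝓜, h𝓜⟩ := h𝓜
  exact ⟨⟨𝓜.E, 𝓜.C * C₀, 𝓜.isUnit_Δ, by rw [mul_smul, h, 𝓜.smul_eq]⟩, h𝓜⟩

/-- Transport along a change of variables over `ℚ`: `V = C₀ • W`. [cite: SilvermanAEC2009, III.1] -/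
theorem exists_specialFibreTrace_of_smul_rat {W V : WeierstrassCurve ℚ} (C₀ : VariableChange ℚ)
    (h : C₀ • W = V) (t : ℤ)
    (h𝓜 : ∃ 𝓜 : V.NineGoodModel, ∀ ρ : ONine →+* ZMod 3, 𝓜.specialFibreTrace ρ = t) :
    ∃ 𝓜 : W.NineGoodModel, ∀ ρ : ONine →+* ZMod 3, 𝓜.specialFibreTrace ρ = t :=
  exists_specialFibreTrace_of_smul (C₀.map (algebraMap ℚ KNine)) (by rw [map_variableChange, h]) t h𝓜

/-! ### Integer cubics read in `KNine` -/

/-- An integer cubic over `ℚ` read in `KNine`. [folklore] -/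
theorem cubic_map_KNine (A B C : ℤ) :
    ((⟨0, A, 0, B, C⟩ : WeierstrassCurve ℤ).map (Int.castRingHom ℚ)).map (algebraMap ℚ KNine) =
      ⟨0, (A : KNine), 0, (B : KNine), (C : KNine)⟩ := by
  rw [WeierstrassCurve.map_map, cubic_map]; ext <;> simp

/-- The cusp translation over `KNine`: `(1, t, 0, 0) • (A, B, C) = (A + 3t, B + 2tA + 3t², C + tB + t²A + t³)`.
[cite: SilvermanAEC2009, III.1 Table 3.1] -/
theorem translate_smul_KNine (A B C t : ℤ) :
    (⟨1, (t : KNine), 0, 0⟩ : VariableChange KNine) •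
        ((⟨0, A, 0, B, C⟩ : WeierstrassCurve ℤ).map (Int.castRingHom ℚ)).map (algebraMap ℚ KNine) =
      ((⟨0, A + 3 * t, 0, B + 2 * t * A + 3 * t ^ 2, C + t * B + t ^ 2 * A + t ^ 3⟩ : WeierstrassCurve ℤ).map
        (Int.castRingHom ℚ)).map (algebraMap ℚ KNine) := by
  rw [cubic_map_KNine, cubic_map_KNine, translate_smul]
  ext <;> push_cast <;> ring

/-- **The `√−3`-rescaling is a `KNine`-isomorphism**: `(2ζ³+1, 0, 0, 0) • (9a, 27b, 27c) = (−3a, 3b, −c)`.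
[cite: SilvermanAEC2009, III.1 Table 3.1] -/
theorem twist_smul_KNine (a b c : ℤ) :
    (⟨Units.mk0 (2 * (IsCyclotomicExtension.zeta 9 ℚ_[3] KNine) ^ 3 + 1 : KNine)
        (sigma_ne_zero (IsCyclotomicExtension.zeta_spec 9 ℚ_[3] KNine)), 0, 0, 0⟩ : VariableChange KNine) •
        ((⟨0, 9 * a, 0, 27 * b, 27 * c⟩ : WeierstrassCurve ℤ).map (Int.castRingHom ℚ)).map (algebraMap ℚ KNine) =
      ((⟨0, -(3 * a), 0, 3 * b, -c⟩ : WeierstrassCurve ℤ).map (Int.castRingHom ℚ)).map (algebraMap ℚ KNine) := by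
  set ζ : KNine := IsCyclotomicExtension.zeta 9 ℚ_[3] KNine with hζdef
  have hζ : IsPrimitiveRoot ζ 9 := IsCyclotomicExtension.zeta_spec 9 ℚ_[3] KNine
  have hσ := sigma_sq hζ
  rw [cubic_map_KNine, cubic_map_KNine, chg_smul_cubic (2 * ζ ^ 3 + 1 : KNine) (sigma_ne_zero hζ)]
  have hs2 : (2 * ζ ^ 3 + 1 : KNine)⁻¹ ^ 2 = -1 / 3 := by rw [inv_pow, hσ]; norm_num
  have hs4 : (2 * ζ ^ 3 + 1 : KNine)⁻¹ ^ 4 = 1 / 9 := by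
    rw [show (4 : ℕ) = 2 * 2 from rfl, pow_mul, hs2]; norm_num
  have hs6 : (2 * ζ ^ 3 + 1 : KNine)⁻¹ ^ 6 = -1 / 27 := by
    rw [show (6 : ℕ) = 2 * 3 from rfl, pow_mul, hs2]; norm_num
  rw [hs2, hs4, hs6]
  ext <;> push_cast <;> ring

/-! ### The leaves in pattern currency, with the trace -/

/-- `specialFibre = ⟨0,0,0,−1,b̄⟩` gives `specialFibreTrace = 4 − #{y² = x³ − x + b̄}(𝔽₃)`. [folklore] -/
theorem specialFibreTrace_of_specialFibre_eq {W : WeierstrassCurve ℚ} (𝓜 : W.NineGoodModel)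
    (ρ : ONine →+* ZMod 3) (b : ZMod 3) (h : 𝓜.specialFibre ρ = ⟨0, 0, 0, -1, b⟩) :
    𝓜.specialFibreTrace ρ = 4 - (Nat.card (⟨0, 0, 0, -1, b⟩ : WeierstrassCurve (ZMod 3)).toAffine.Point : ℤ) := by
  unfold NineGoodModel.specialFibreTrace
  rw [h]

/-- Leaf II in pattern form `(3ε + 9α', 9β', −3ε + 9γ')`, `ε = ±1`: a good model with trace `psUntwistedTrace` along
every `ρ`. [cite: Kraus1990, Théorème (p = 3)] -/
theorem exists_nineGoodModel_of_pattern_four (A B C ε α' β' γ' : ℤ) (hε : ε = 1 ∨ ε = -1)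
    (hA : A = 3 * ε + 9 * α') (hB : B = 9 * β') (hC : C = -3 * ε + 9 * γ') :
    ∃ 𝓜 : ((⟨0, A, 0, B, C⟩ : WeierstrassCurve ℤ).map (Int.castRingHom ℚ)).NineGoodModel,
      ∀ ρ : ONine →+* ZMod 3, 𝓜.specialFibreTrace ρ =
        ((⟨0, A, 0, B, C⟩ : WeierstrassCurve ℤ).map (Int.castRingHom ℚ)).psUntwistedTrace := by
  have hg : (-ε) ^ 2 = 1 := by rcases hε with rfl | rfl <;> norm_num
  have hA' : A = 3 * (3 * α' - -ε) := by rw [hA]; ring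
  have hB' : B = 9 * β' := hB
  have hC' : C = 3 * (3 * γ' + -ε) := by rw [hC]; ring
  subst hA' hB' hC'
  obtain ⟨𝓜, h𝓜⟩ := exists_nineGoodModel_leafII α' β' γ' (-ε) hg
  refine ⟨𝓜, fun ρ ↦ ?_⟩
  rw [specialFibreTrace_of_specialFibre_eq 𝓜 ρ _ (h𝓜 ρ), PSUntwistedTrace.psUntwistedTrace_leafII_eq_trace α' β' γ' hg]
  norm_num

/-- Leaf IV in pattern form `(9α₁, −9 + 27β₂, −9ε + 27γ₂)`, `ε = ±1`: a good model with trace `psUntwistedTrace` along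
every `ρ`. [cite: Kraus1990, Théorème (p = 3)] -/
theorem exists_nineGoodModel_of_pattern_six (A B C ε α₁ β₂ γ₂ : ℤ) (hε : ε = 1 ∨ ε = -1)
    (hA : A = 9 * α₁) (hB : B = -9 + 27 * β₂) (hC : C = -9 * ε + 27 * γ₂) :
    ∃ 𝓜 : ((⟨0, A, 0, B, C⟩ : WeierstrassCurve ℤ).map (Int.castRingHom ℚ)).NineGoodModel,
      ∀ ρ : ONine →+* ZMod 3, 𝓜.specialFibreTrace ρ =
        ((⟨0, A, 0, B, C⟩ : WeierstrassCurve ℤ).map (Int.castRingHom ℚ)).psUntwistedTrace := by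
  have hg : (-ε) ^ 2 = 1 := by rcases hε with rfl | rfl <;> norm_num
  have hA' : A = 9 * α₁ := hA
  have hB' : B = 9 * (3 * β₂ - 1) := by rw [hB]; ring
  have hC' : C = 9 * (3 * γ₂ + -ε) := by rw [hC]; ring
  subst hA' hB' hC'
  obtain ⟨𝓜, h𝓜⟩ := exists_nineGoodModel_leafIV α₁ β₂ γ₂ (-ε) hg
  refine ⟨𝓜, fun ρ ↦ ?_⟩
  rw [specialFibreTrace_of_specialFibre_eq 𝓜 ρ _ (h𝓜 ρ), PSUntwistedTrace.psUntwistedTrace_leafIV_eq_trace α₁ β₂ γ₂ hg]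
  norm_num

/-! ### The cubic-level existence -/

/-- **Low discriminant valuation (`1 ≤ v ≤ 7`)**: the integer cubic of `GNineCriterion` shape has a good model over
`𝓞_{ℚ₃(ζ₉)}` whose special-fibre trace along every reduction map is `psUntwistedTrace`.
[cite: Kraus1990, Théorème (p = 3)] [cite: Tate1975, §7] -/
theorem exists_nineGoodModel_cubic_low (A B C : ℤ) (v : ℕ) (d : ℤ) (h3A : (3 : ℤ) ∣ A)
    (hD : A ^ 2 * B ^ 2 - 4 * B ^ 3 - 4 * A ^ 3 * C - 27 * C ^ 2 + 18 * A * B * C = 3 ^ v * d)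
    (hd : d % 3 = 1) (hv : Even v) (hv1 : 1 ≤ v) (hv7 : v ≤ 7)
    (hP : v = 6 → (3 : ℤ) ^ 5 ∣ 2 * A ^ 3 - 9 * A * B + 27 * C ∧ ¬ (3 : ℤ) ^ 6 ∣ 2 * A ^ 3 - 9 * A * B + 27 * C) :
    ∃ 𝓜 : ((⟨0, A, 0, B, C⟩ : WeierstrassCurve ℤ).map (Int.castRingHom ℚ)).NineGoodModel,
      ∀ ρ : ONine →+* ZMod 3, 𝓜.specialFibreTrace ρ =
        ((⟨0, A, 0, B, C⟩ : WeierstrassCurve ℤ).map (Int.castRingHom ℚ)).psUntwistedTrace := by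
  have hΔ0 : (⟨0, A, 0, B, C⟩ : WeierstrassCurve ℤ).Δ ≠ 0 := cubic_int_Δ_ne_zero hD hd
  have h3D : (3 : ℤ) ∣ A ^ 2 * B ^ 2 - 4 * B ^ 3 - 4 * A ^ 3 * C - 27 * C ^ 2 + 18 * A * B * C := by
    rw [hD]; exact dvd_mul_of_dvd_left (dvd_pow_self 3 (by omega)) d
  obtain ⟨t, htA, htB, htC⟩ := exists_translate_three_dvd A B C h3A h3D
  rw [← psUntwistedTrace_cubic_translate A B C t hΔ0]
  refine exists_specialFibreTrace_of_smul _ (translate_smul_KNine A B C t) _ ?_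
  set A' : ℤ := A + 3 * t with hA'
  set B' : ℤ := B + 2 * t * A + 3 * t ^ 2 with hB'
  set C' : ℤ := C + t * B + t ^ 2 * A + t ^ 3 with hC'
  have hD' : A' ^ 2 * B' ^ 2 - 4 * B' ^ 3 - 4 * A' ^ 3 * C' - 27 * C' ^ 2 + 18 * A' * B' * C' =
      3 ^ v * d := by rw [hA', hB', hC', disc_translate, hD]
  have hP' : 2 * A' ^ 3 - 9 * A' * B' + 27 * C' = 2 * A ^ 3 - 9 * A * B + 27 * C := by
    rw [hA', hB', hC', csix_translate]
  obtain ⟨a, ha⟩ := htA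
  obtain ⟨b, hb⟩ := htB
  obtain ⟨c, hc⟩ := htC
  have h27 : (27 : ℤ) ∣ 3 ^ v * d := by
    rw [← hD', ha, hb, hc, disc_eq_of_three_dvd]; exact dvd_mul_right 27 _
  have hv46 : v = 4 ∨ v = 6 := by obtain ⟨k, hk⟩ := hv; interval_cases v <;> omega
  clear_value A' B' C'
  rcases hv46 with rfl | rfl
  · obtain ⟨ε, α', β', γ', hε, h1, h2, h3'⟩ :=
      pattern_four A' B' C' d ⟨a, ha⟩ ⟨b, hb⟩ ⟨c, hc⟩ (by linarith) hd
    exact exists_nineGoodModel_of_pattern_four A' B' C' ε α' β' γ' hε h1 h2 h3'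
  · rcases pattern_six A' B' C' d ⟨a, ha⟩ ⟨b, hb⟩ ⟨c, hc⟩ (by linarith) hd with
      ⟨a₁, b₁, c₁, h1, h2, h3'⟩ | ⟨ε, α₁, β₂, γ₂, hε, h1, h2, h3'⟩
    · exfalso
      obtain ⟨h5, h6⟩ := hP rfl
      rw [← hP', h1, h2, h3'] at h5 h6
      exact false_of_IzeroStar_shape a₁ b₁ c₁ h5 h6
    · exact exists_nineGoodModel_of_pattern_six A' B' C' ε α₁ β₂ γ₂ hε h1 h2 h3'

/-- **The cubic-level existence** (`1 ≤ v ≤ 13`; the `√−3`-rescaling over `KNine` for `v ≥ 8`).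
[cite: Kraus1990, Théorème (p = 3)] [cite: Tate1975, §7] -/
theorem exists_nineGoodModel_cubic (A B C : ℤ) (v : ℕ) (d : ℤ) (h3A : (3 : ℤ) ∣ A)
    (hD : A ^ 2 * B ^ 2 - 4 * B ^ 3 - 4 * A ^ 3 * C - 27 * C ^ 2 + 18 * A * B * C = 3 ^ v * d)
    (hd : d % 3 = 1) (hv : Even v) (hv1 : 1 ≤ v) (hv13 : v ≤ 13)
    (hc4 : 8 ≤ v → (27 : ℤ) ∣ A ^ 2 - 3 * B)
    (hP6 : v = 6 → (3 : ℤ) ^ 5 ∣ 2 * A ^ 3 - 9 * A * B + 27 * C ∧ ¬ (3 : ℤ) ^ 6 ∣ 2 * A ^ 3 - 9 * A * B + 27 * C)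
    (hP12 : v = 12 → (3 : ℤ) ^ 8 ∣ 2 * A ^ 3 - 9 * A * B + 27 * C ∧ ¬ (3 : ℤ) ^ 9 ∣ 2 * A ^ 3 - 9 * A * B + 27 * C) :
    ∃ 𝓜 : ((⟨0, A, 0, B, C⟩ : WeierstrassCurve ℤ).map (Int.castRingHom ℚ)).NineGoodModel,
      ∀ ρ : ONine →+* ZMod 3, 𝓜.specialFibreTrace ρ =
        ((⟨0, A, 0, B, C⟩ : WeierstrassCurve ℤ).map (Int.castRingHom ℚ)).psUntwistedTrace := by
  by_cases hv7 : v ≤ 7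
  · exact exists_nineGoodModel_cubic_low A B C v d h3A hD hd hv hv1 hv7 hP6
  have hv8 : 8 ≤ v := by omega
  have hΔ0 : (⟨0, A, 0, B, C⟩ : WeierstrassCurve ℤ).Δ ≠ 0 := cubic_int_Δ_ne_zero hD hd
  have h3D : (3 : ℤ) ∣ A ^ 2 * B ^ 2 - 4 * B ^ 3 - 4 * A ^ 3 * C - 27 * C ^ 2 + 18 * A * B * C := by
    rw [hD]; exact dvd_mul_of_dvd_left (dvd_pow_self 3 (by omega)) d
  obtain ⟨t, htA, htB, htC⟩ := exists_translate_three_dvd A B C h3A h3D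
  rw [← psUntwistedTrace_cubic_translate A B C t hΔ0]
  refine exists_specialFibreTrace_of_smul _ (translate_smul_KNine A B C t) _ ?_
  set A' : ℤ := A + 3 * t with hA'
  set B' : ℤ := B + 2 * t * A + 3 * t ^ 2 with hB'
  set C' : ℤ := C + t * B + t ^ 2 * A + t ^ 3 with hC'
  have hD' : A' ^ 2 * B' ^ 2 - 4 * B' ^ 3 - 4 * A' ^ 3 * C' - 27 * C' ^ 2 + 18 * A' * B' * C' =
      3 ^ v * d := by rw [hA', hB', hC', disc_translate, hD]
  have hP' : 2 * A' ^ 3 - 9 * A' * B' + 27 * C' = 2 * A ^ 3 - 9 * A * B + 27 * C := by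
    rw [hA', hB', hC', csix_translate]
  have hc4' : (27 : ℤ) ∣ A' ^ 2 - 3 * B' := by rw [hA', hB', csub_translate]; exact hc4 hv8
  have h8 : (3 : ℤ) ^ 8 ∣ A' ^ 2 * B' ^ 2 - 4 * B' ^ 3 - 4 * A' ^ 3 * C' - 27 * C' ^ 2
      + 18 * A' * B' * C' := by
    rw [hD']; exact dvd_mul_of_dvd_left (pow_dvd_pow 3 hv8) d
  obtain ⟨a, b, c, h1, h2, h3'⟩ := pattern_high A' B' C' htA htB htC h8 hc4'
  clear_value A' B' C'
  subst h1 h2 h3'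
  obtain ⟨m, hm⟩ : ∃ m : ℕ, v = m + 6 := ⟨v - 6, by omega⟩
  have hDtw : (-(3 * a)) ^ 2 * (3 * b) ^ 2 - 4 * (3 * b) ^ 3 - 4 * (-(3 * a)) ^ 3 * (-c)
      - 27 * (-c) ^ 2 + 18 * (-(3 * a)) * (3 * b) * (-c) = 3 ^ m * d := by
    have key := disc_twist a b c
    rw [hD', hm, pow_add] at key
    have h36 : (3 : ℤ) ^ 6 ≠ 0 := by norm_num
    apply mul_right_cancel₀ h36
    linarith
  have hΔtw : (⟨0, -(3 * a), 0, 3 * b, -c⟩ : WeierstrassCurve ℤ).Δ ≠ 0 := cubic_int_Δ_ne_zero hDtw hd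
  rw [psUntwistedTrace_cubic_twist a b c hΔtw]
  refine exists_specialFibreTrace_of_smul _ (twist_smul_KNine a b c) _ ?_
  have hmeven : Even m := by obtain ⟨k, hk⟩ := hv; exact ⟨k - 3, by omega⟩
  refine exists_nineGoodModel_cubic_low (-(3 * a)) (3 * b) (-c) m d ⟨-a, by ring⟩ hDtw hd hmeven
    (by omega) (by omega) fun hm6 ↦ ?_
  have hv12 : v = 12 := by omega
  obtain ⟨h8P, h9P⟩ := hP12 hv12
  rw [← hP', csix_twist] at h8P h9P
  have h27 : (3 : ℤ) ^ 3 ≠ 0 := by norm_num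
  constructor
  · have h' : (3 : ℤ) ^ 3 * 3 ^ 5 ∣ (3 : ℤ) ^ 3 *
        -(2 * (-(3 * a)) ^ 3 - 9 * (-(3 * a)) * (3 * b) + 27 * (-c)) := by
      have e : (3 : ℤ) ^ 3 * -(2 * (-(3 * a)) ^ 3 - 9 * (-(3 * a)) * (3 * b) + 27 * (-c)) =
          -27 * (2 * (-(3 * a)) ^ 3 - 9 * (-(3 * a)) * (3 * b) + 27 * (-c)) := by ring
      rw [e, ← pow_add]; exact h8P
    exact (dvd_neg.mp ((mul_dvd_mul_iff_left h27).mp h'))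
  · intro h6
    apply h9P
    have e : -27 * (2 * (-(3 * a)) ^ 3 - 9 * (-(3 * a)) * (3 * b) + 27 * (-c)) =
        (3 : ℤ) ^ 3 * -(2 * (-(3 * a)) ^ 3 - 9 * (-(3 * a)) * (3 * b) + 27 * (-c)) := by ring
    rw [e, show (9 : ℕ) = 3 + 6 from rfl, pow_add]
    exact mul_dvd_mul_left _ (dvd_neg.mpr h6)

/-! ### The W-level existence and the stub modulo the existence fact -/

section Main

variable (W : WeierstrassCurve ℚ) [W.IsElliptic] [W.IsGloballyMinimal]

/-- **Every principal-series row has a good model over `𝓞_{ℚ₃(ζ₉)}` with special-fibre trace `a_w` along EVERY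
reduction map.** For `W/ℚ` elliptic, globally minimal, `ClassO6 W 3`, `v₃(Δ_min)` even, `Δ_min/3^v ≡ 1 (mod 3)`:
`∃ 𝓜 : W.NineGoodModel, ∀ ρ : ONine →+* ZMod 3, 𝓜.specialFibreTrace ρ = W.psUntwistedTrace` (bridge (B1) of the
lane memo LAW-La3-KERNEL-v5 §2). [cite: Kraus1990, Théorème (p = 3)] [cite: Tate1975, §7] [cite: SilvermanAEC2009, VII.1] -/
theorem exists_nineGoodModel_specialFibreTrace_of_psRow (hO6 : ClassO6 W 3)
    (hev : Even (padicValInt 3 W.minimalDiscriminantInt))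
    (hsq : W.minimalDiscriminantInt / 3 ^ padicValInt 3 W.minimalDiscriminantInt % 3 = 1) :
    ∃ 𝓜 : W.NineGoodModel, ∀ ρ : ONine →+* ZMod 3, 𝓜.specialFibreTrace ρ = W.psUntwistedTrace := by
  haveI hp3 : Fact (Nat.Prime 3) := ⟨Nat.prime_three⟩
  have hadd : Addv W 3 := hO6.2.1
  have hpm : ¬ PotMult W 3 := hO6.2.2.1
  obtain ⟨hvals, hP6, hP12⟩ := kodairaSignature_P W hO6 hev
  have hc4W : 7 ≤ padicValInt 3 (integralModelInt W).Δ → (27 : ℤ) ∣ (integralModelInt W).c₄ :=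
    twentySeven_dvd_c₄_of_not_potMult W hpm
  -- integer data
  set E₀ : WeierstrassCurve ℤ := integralModelInt W with hE₀
  set A : ℤ := E₀.b₂ with hA
  set B : ℤ := 8 * E₀.b₄ with hB
  set C : ℤ := 16 * E₀.b₆ with hC
  set v : ℕ := padicValInt 3 E₀.Δ with hvdef
  have hmin : W.minimalDiscriminantInt = E₀.Δ := rfl
  rw [hmin] at hev hsq
  have hc4E : E₀.c₄ = A ^ 2 - 3 * B := c₄_eq_b₂_sq_sub E₀
  have hDE : A ^ 2 * B ^ 2 - 4 * B ^ 3 - 4 * A ^ 3 * C - 27 * C ^ 2 + 18 * A * B * C =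
      256 * E₀.Δ := disc_b_eq E₀
  have hPE : 2 * A ^ 3 - 9 * A * B + 27 * C = -2 * E₀.c₆ := csix_of_b E₀
  have hΔ0 : E₀.Δ ≠ 0 := minimalDiscriminantInt_ne_zero W
  have h3c4 : (3 : ℤ) ∣ A ^ 2 - 3 * B := hc4E ▸ three_dvd_c₄_of_addv W hadd
  have h3A : (3 : ℤ) ∣ A := by
    have : (3 : ℤ) ∣ A ^ 2 := by
      have := dvd_add h3c4 (dvd_mul_right 3 B)
      simpa using this
    exact Int.prime_three.dvd_of_dvd_pow this
  have hv1 : 1 ≤ v := by rcases hvals with h | h | h | h <;> omega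
  have hv13 : v ≤ 13 := by rcases hvals with h | h | h | h <;> omega
  obtain ⟨d₀, hd₀⟩ : (3 : ℤ) ^ v ∣ E₀.Δ := (three_pow_dvd_iff v E₀.Δ).mpr (Or.inr le_rfl)
  have hd₀' : E₀.Δ / 3 ^ v = d₀ := by
    rw [hd₀, Int.mul_ediv_cancel_left _ (pow_ne_zero _ (by norm_num))]
  rw [hd₀'] at hsq
  have hD : A ^ 2 * B ^ 2 - 4 * B ^ 3 - 4 * A ^ 3 * C - 27 * C ^ 2 + 18 * A * B * C =
      3 ^ v * (256 * d₀) := by rw [hDE, hd₀]; ring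
  have hd : 256 * d₀ % 3 = 1 := by omega
  have hc4 : 8 ≤ v → (27 : ℤ) ∣ A ^ 2 - 3 * B := fun h8 ↦ by
    rw [← hc4E]; exact hc4W (by omega)
  have hP6' : v = 6 → (3 : ℤ) ^ 5 ∣ 2 * A ^ 3 - 9 * A * B + 27 * C ∧
      ¬ (3 : ℤ) ^ 6 ∣ 2 * A ^ 3 - 9 * A * B + 27 * C := fun h ↦ by rw [hPE]; exact hP6 h
  have hP12' : v = 12 → (3 : ℤ) ^ 8 ∣ 2 * A ^ 3 - 9 * A * B + 27 * C ∧
      ¬ (3 : ℤ) ^ 9 ∣ 2 * A ^ 3 - 9 * A * B + 27 * C := fun h ↦ by rw [hPE]; exact hP12 h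
  -- the cubic-level existence, transported along the cubic-model change over `ℚ`
  obtain h𝓜 := exists_nineGoodModel_cubic A B C v (256 * d₀) h3A hD hd hev hv1 hv13 hc4 hP6' hP12'
  have h2Q : (2 : ℚ) ≠ 0 := two_ne_zero
  have hcubQ : (⟨Units.mk0 (2 : ℚ)⁻¹ (inv_ne_zero h2Q), 0, -(E₀.map (Int.castRingHom ℚ)).a₁ / 2,
      -(E₀.map (Int.castRingHom ℚ)).a₃ / 2⟩ : VariableChange ℚ) • E₀.map (Int.castRingHom ℚ) =
      (⟨0, A, 0, B, C⟩ : WeierstrassCurve ℤ).map (Int.castRingHom ℚ) := by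
    rw [cubicModel_smul h2Q, map_b₂, map_b₄, map_b₆, hA, hB, hC, cubic_map]
    ext <;> simp
  have hWQ : E₀.map (Int.castRingHom ℚ) = W := by rw [hE₀, map_integralModelInt]
  have hΔQ : (E₀.map (Int.castRingHom ℚ)).Δ ≠ 0 := by
    rw [map_Δ, eq_intCast]; exact_mod_cast hΔ0
  have htr : ((⟨0, A, 0, B, C⟩ : WeierstrassCurve ℤ).map (Int.castRingHom ℚ)).psUntwistedTrace =
      W.psUntwistedTrace := by
    rw [← hcubQ, PSUntwistedTrace.psUntwistedTrace_variableChange _ _ hΔQ, hWQ]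
  rw [← htr]
  rw [hWQ] at hcubQ
  exact exists_specialFibreTrace_of_smul_rat _ hcubQ _ h𝓜

/-- **`stub_descendedFrobenius` of line `dfrob`, GRANTED the existence fact and a reduction map.** For every
reduction map `ρ : 𝓞_{ℚ₃(ζ₉)} →+* ZMod 3` and under the Literature named fact `isDescendedFrobeniusMatrix_exists`
(Berthelot–Ogus + Katz: PRINT), on every principal-series row (`ClassO6 W 3`, `v₃Δ_min` even,
`Δ_min/3^v ≡ 1 (mod 3)`): `∃ M, W.IsDescendedFrobeniusMatrix M ∧ tr M = ↑(W.psUntwistedTrace) ∧ M 1 0 ≠ 0` — the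
registered stub text verbatim after the two granted inputs. Proof: the good model of
`exists_nineGoodModel_specialFibreTrace_of_psRow` has `3 ∣ specialFibreTrace = a_w` (`three_dvd_psUntwistedTrace`), so the
fact yields `M` with `tr M = specialFibreTrace = a_w`, and `M₁₀ ≠ 0` is `IsDescendedFrobeniusMatrix.entry_one_zero_ne_zero`.
[cite: BerthelotOgus1983, Thm. (2.4) and Prop. (3.14)] [cite: Katz1981CrystallineDieudonne, Thm. 5.1.4 and (6.1.1)] -/
theorem stub_descendedFrobenius_of_exists (hex : WeierstrassCurve.isDescendedFrobeniusMatrix_exists)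
    (ρ : ONine →+* ZMod 3) :
    ∀ (W : WeierstrassCurve ℚ) [W.IsElliptic] [W.IsGloballyMinimal],
      Summit.BirchSwinnertonDyer.Rank1Residual.Additive.ClassO6 W 3 →
      Even (padicValInt 3 W.minimalDiscriminantInt) →
      W.minimalDiscriminantInt / 3 ^ padicValInt 3 W.minimalDiscriminantInt % 3 = 1 →
      ∃ M : Matrix (Fin 2) (Fin 2) ℚ_[3], W.IsDescendedFrobeniusMatrix M ∧
        M.trace = ((W.psUntwistedTrace : ℤ) : ℚ_[3]) ∧ M 1 0 ≠ 0 := by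
  intro W _ _ hO6 hev hsq
  obtain ⟨𝓜, h𝓜⟩ := exists_nineGoodModel_specialFibreTrace_of_psRow W hO6 hev hsq
  have hss : (3 : ℤ) ∣ 𝓜.specialFibreTrace ρ := by
    rw [h𝓜 ρ]; exact PSUntwistedTrace.three_dvd_psUntwistedTrace W
  obtain ⟨M, hM, htr⟩ := hex W 𝓜 ρ hss
  exact ⟨M, hM, by rw [htr, h𝓜 ρ], hM.entry_one_zero_ne_zero hex 𝓜 ρ hss⟩

end Main

end Summit.BirchSwinnertonDyer.BirchSwinnertonDyer.Theorems.GNineFrobeniusTrace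

end
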